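import Literature.NumberTheory.Rogawski1990.UnitOrbitalIntegralInertValueTHOfKappa                 -- ★ B-p12 p842304: (β)+(γ) assembled in the stub frame
import Literature.NumberTheory.Rogawski1990.UnitFundamentalLemmaInertSplitValueOne                  -- ★ p04: the X₁ closer (idiom + imports: frame, transport, fixed points, `IsAdicComplete`)
import Literature.NumberTheory.Automorphic.UnitaryTypeTwoNormPairCentralizerCompact                 -- ★ B-p10 p842297 (E4″): `CompactSpace Z(δ)` for type-(2) norm pairs
import Literature.NumberTheory.Rogawski1990.UnitFundamentalLemmaInertFlickerScalarsCM               -- ★ `exists_flicker_scalars_of_nonsplit` (`y ȳ = −2`)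
import Literature.NumberTheory.Rogawski1990.FinExplicitTransferFactorNondegenerate                  -- ★ `isUnit_eval_finCharpolyTwo_of_isLocalGRegular`
import Literature.NumberTheory.Rogawski1990.LocalTransferLinear                                     -- ★ `isRegularElt_of_isLocalNormPair`
import Literature.NumberTheory.Automorphic.SplitOrthogonalUnramifiedDatum                           -- ★ `valued_two_adicCompletion_eq_one`
import HarnessLib

/-!
# `stub_irredGValuePos` (:1189) PAID: `Φ(⟦δ⟧, 1_{K′}) = phiTHn q n N` for every match `δ` of a type-(2) `γ_H` with `κ_v(γ_H, δ) = +1`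
(Flicker (1998) Theorem 18 p. 97, Prop. 11 p. 87; Rogawski (1990) Prop. 4.9.1 (b))

Topic `NumberTheory/Rogawski1990`; namespace `Literature.NumberTheory.Rogawski1990`.  THEOREMS ONLY; kernel lane.  Cell `pub/hodgecm-mathlib`, crux H413 =
`stmt-HodgeConjecture-24833`, road «N7-ns COUNT FROM FLICKER», line «N7nsCount» (tree `Cruxes/H413/Lines/F0_P3a_N7nsCount.lean` ED. 1.5), the κ = +1 VALUE STUB
`stub_irredGValuePos` — B-p12 (g28), LEAD F0P3a-plan (g9) T8-131 ∕ T8-146.  **`classOrbitalIntegral_indicator_eq_phiTHn_of_finKappaAt_eq_one`** concludes the stub's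
statement for `δ` (binders: the stub's, BY NAME, only those used; the line's fold is `stub_irredGValuePos … := fun δ hδ hκ => ‹this› … δ hδ hκ`).  PROOF = (α) the
transport `Φ(⟦δ⟧, 1_{K′}) = #Fix_{U(L_w)⧸K}(e δ)` along F0P3-p02's frame `e g = T g_w T⁻¹` (★ `exists_glInt_placeForm_eq_formCongr_antidiagonal_of_isUnramifiedIn`, ★
`localNonsplitCongr`, ★ `mem_cmLocalIntegralLevel_iff_conj_mem_glInt`; ★ p04 `classOrbitalIntegral_indicator_complex_cmLocalIntegralLevel_eq_natCard_fixedBy` with `δ` regular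
(★ `isRegularElt_of_isLocalNormPair`) and `Z(δ)` compact (★ B-p10 `compactSpace_centralizer_of_isLocalNormPair_of_not_exists_isRoot`); ★ F0P3-p02
`natCard_fixedBy_cmLocalIntegralLevel_eq_of_frame`, finiteness ★ `finite_fixedBy_quotient_of_isClosed`) ∘ (β)+(γ) ★ B-p12 `natCard_fixedPoints_eq_phiTHn_of_finKappaAt_eq_one`
(p842304), with `y ȳ = −2` from ★ `exists_flicker_scalars_of_nonsplit` and `[IsAdicComplete 𝓂 𝒪_w]` from ★ `isAdicComplete_maximalIdeal_valuedInteger_adicCompletion`.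
HONEST LABEL: HC_CM is proved only modulo the printed citations (2 remaining named inputs hLiu418, h413) until rung 0 closes; this pays ONE value stub of the line.

## References
* [Flicker1998UnitaryFL] Y. Z. Flicker, *Elementary proof of the fundamental lemma for a unitary group*, Canad. J. Math. 50 (1998): Prop. 11 p. 87, Theorem 18 p. 97.
* [Rogawski1990] J. D. Rogawski, *Automorphic Representations of Unitary Groups in Three Variables* (1990), §4.9 Prop. 4.9.1 (b) p. 55, §14.2 p. 233.
-/

set_option autoImplicit false

noncomputable section

open MeasureTheory Measure NumberField IsDedekindDomain Matrix Polynomial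
open scoped MatrixGroups WithZero ValuativeRel

namespace Literature.NumberTheory.Rogawski1990

open Literature.NumberTheory.Automorphic Literature.NumberTheory.Automorphic.UnitaryGroup
open Literature.NumberTheory.Automorphic.HermitianLattice
open Literature.NumberTheory.GaloisRepresentations Literature.NumberTheory.NumberFields

variable (L : Type) [Field L] [NumberField L] [IsCMField L] (H' : Matrix (Fin 3) (Fin 3) L)
  {v : HeightOneSpectrum (𝓞 ↥(maximalRealSubfield L))}

set_option maxHeartbeats 1600000 in
set_option synthInstance.maxHeartbeats 200000 in
-- frame terms are large
/-- **`stub_irredGValuePos` PAID**: at a finite place `v` of `L⁺` non-split and unramified in `L`, of good reduction for `H′`, `2` a unit, for a `G`-regular type-(2)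
`γ_H` (`χ_g` irreducible over `L_w`, complementary exponent `2N+1`, observable exponent `n`) and EVERY match `δ ∈ G′_v` with `κ_v(γ_H, δ) = +1`:
`Φ(⟦δ⟧, 1_{K′}) = phiTHn q n N`. [cite: Flicker1998UnitaryFL, Theorem 18 p. 97; Prop. 11 p. 87] [cite: Rogawski1990, §4.9 Prop. 4.9.1 (b) p. 55] -/
theorem classOrbitalIntegral_indicator_eq_phiTHn_of_finKappaAt_eq_one
    (hH' : (H'.map (IsCMField.complexConj L))ᵀ = H') (w : PlacesOver L v)
    (hw : IsCMField.complexConj L • w.1 = w.1) (hv : Algebra.IsUnramifiedIn (𝓞 L) v.asIdeal)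
    (hH'w : IsUnit (placeForm H' w.1)) (hH'i : hH'w.unit ∈ glInt 3 (w.1.adicCompletion L))
    [MeasurableSpace ((cmDatum L 3 H').Local v)] [BorelSpace ((cmDatum L 3 H').Local v)]
    [∀ γ : ((cmDatum L 3 H').Local v), MeasurableSpace (((cmDatum L 3 H').Local v) ⧸ Subgroup.centralizer ({γ} : Set ((cmDatum L 3 H').Local v)))]
    [∀ γ : ((cmDatum L 3 H').Local v), BorelSpace (((cmDatum L 3 H').Local v) ⧸ Subgroup.centralizer ({γ} : Set ((cmDatum L 3 H').Local v)))]
    (νG : Measure ((cmDatum L 3 H').Local v)) [νG.IsHaarMeasure] [νG.IsMulRightInvariant]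
    {mG : OrbitalMeasureFamily ((cmDatum L 3 H').Local v)}
    (hmG : mG.IsCanonical (fun γ => IsRegularElt (γ.val : GL (Fin 3) (UnitaryGroup.LocalRing L v))) νG)
    (hνG : νG (cmLocalIntegralLevel L 3 H' v : Set ((cmDatum L 3 H').Local v)) = 1)
    (hH'u : IsUnit H') (h2 : IsUnit (2 : 𝒪[w.1.adicCompletion L]))
    {γH : (cmDatum L 2 (Matrix.of fun i j : Fin 2 => if i.val + j.val + 1 = 2 then (1 : L) else 0)).Local v ×
      (cmDatum L 1 (Matrix.of fun i j : Fin 1 => if i.val + j.val + 1 = 1 then (1 : L) else 0)).Local v}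
    (hreg : IsLocalGRegular L v γH)
    (hint : ∀ i : ℕ, ((((endoEmbLocal L v γH).val : GL (Fin 3) (LocalRing L v)).val.map
        (Pi.evalRingHom (fun w' : PlacesOver L v => w'.1.adicCompletion L) w)).charpoly.coeff i) ∈ 𝒪[w.1.adicCompletion L])
    (hirr : ¬ ∃ x : w.1.adicCompletion L, (((γH.1.val : GL (Fin 2) (LocalRing L v)).val.map
        (Pi.evalRingHom (fun w' : PlacesOver L v => w'.1.adicCompletion L) w)).charpoly).IsRoot x)
    (n N : ℕ)
    (hn : Valued.v (((finCharpolyTwo L v γH).eval (finGammaTwo L v γH)) w) = WithZero.exp (-(n : ℤ)))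
    (hN : Valued.v (((γH.1.val : GL (Fin 2) (LocalRing L v)).val.map
        (Pi.evalRingHom (fun w' : PlacesOver L v => w'.1.adicCompletion L) w)).trace ^ 2 -
      4 * ((γH.1.val : GL (Fin 2) (LocalRing L v)).val.map
        (Pi.evalRingHom (fun w' : PlacesOver L v => w'.1.adicCompletion L) w)).det) = WithZero.exp (-((2 * N + 1 : ℕ) : ℤ)))
    (δ : (cmDatum L 3 H').Local v) (h : IsLocalNormPair L H' v γH δ) (hκ : finKappaAt L v H' γH δ = 1) :
    classOrbitalIntegral mG ((cmLocalIntegralLevel L 3 H' v : Set ((cmDatum L 3 H').Local v)).indicator fun _ => (1 : ℂ)) (ConjClasses.mk δ) =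
      ((Flicker1998.phiTHn (Ideal.absNorm v.asIdeal) n N : ℚ) : ℂ) := by
  classical
  have hc1 : IsCMField.complexConj L ≠ 1 := IsCMField.complexConj_ne_one L
  haveI : Algebra.IsQuadraticExtension ↥(maximalRealSubfield L) L := IsCMField.isQuadraticExtension L
  haveI : IsAdicComplete (IsLocalRing.maximalIdeal (Valued.integer (w.1.adicCompletion L))) (Valued.integer (w.1.adicCompletion L)) :=
    isAdicComplete_maximalIdeal_valuedInteger_adicCompletion L w.1
  -- hermitian data in the `cmConjRingHom` spelling
  have hH'c : (H'.map (cmConjRingHom L))ᵀ = H' := by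
    have e1 : H'.map (cmConjRingHom L) = H'.map (IsCMField.complexConj L) := by
      ext i j; simp [Matrix.map_apply, cmConjRingHom_apply]
    rw [e1]; exact hH'
  have hdet : H'.det ≠ 0 := (Matrix.isUnit_iff_isUnit_det _ |>.1 hH'u).ne_zero
  -- (α) regularity and compact centraliser of `δ`
  have hreg' : IsRegularElt (δ.val : GL (Fin 3) (LocalRing L v)) := isRegularElt_of_isLocalNormPair L H' v h hreg
  haveI : CompactSpace (Subgroup.centralizer ({δ} : Set ((cmDatum L 3 H').Local v))) :=
    compactSpace_centralizer_of_isLocalNormPair_of_not_exists_isRoot L v w hw hH'u hv hreg h2 hint hirr N hN δ h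
  -- the frame `e g = T g_w T⁻¹` (F0P3-p02's construction)
  obtain ⟨T, hTint, hJT⟩ := exists_glInt_placeForm_eq_formCongr_antidiagonal_of_isUnramifiedIn ↥(maximalRealSubfield L) L
    (IsCMField.complexConj L) hc1 3 H' hH' v w hw hv hH'w hH'i
  have hF : formCongr (galAdicCompletionMap (L := L) (IsCMField.complexConj L) hw) T (placeForm (Matrix.of fun i j : Fin 3 => if i.val + j.val + 1 = 3 then (1 : L) else 0) w.1) =
      (1 : w.1.adicCompletion L) • placeForm H' w.1 := by
    rw [one_smul, placeForm_antidiagOne, ← hJT]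
  have hT : placeForm H' w.1 = formCongr (galAdicCompletionMap (L := L) (IsCMField.complexConj L) hw) T (placeForm (Matrix.of fun i j : Fin 3 => if i.val + j.val + 1 = 3 then (1 : L) else 0) w.1) := by
    rw [hF, one_smul]
  set e := (localNonsplitCongr (IsCMField.complexConj L) hc1 w hw T isUnit_one hF).trans
    (localNonsplitEquiv (IsCMField.complexConj L) (Matrix.of fun i j : Fin 3 => if i.val + j.val + 1 = 3 then (1 : L) else 0) hc1 w hw) with he
  have hform : ∀ g, ((e g).val : GL (Fin 3) (w.1.adicCompletion L)) =
      T * ((localNonsplitEquiv (IsCMField.complexConj L) H' hc1 w hw g).val : GL (Fin 3) (w.1.adicCompletion L)) * T⁻¹ :=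
    fun g => (congrArg (fun x : ↥(unitaryGroupOfForm (galAdicCompletionMap (L := L) (IsCMField.complexConj L) hw)
        (placeForm (Matrix.of fun i j : Fin 3 => if i.val + j.val + 1 = 3 then (1 : L) else 0) w.1)) => (x.val : GL (Fin 3) (w.1.adicCompletion L))) (ContinuousMulEquiv.trans_apply _ _ g)).trans
      (localNonsplitEquiv_localNonsplitCongr (IsCMField.complexConj L) hc1 w hw T isUnit_one hF g)
  have hlev : ∀ g, g ∈ cmLocalIntegralLevel L 3 H' v ↔ ((e g).val : GL (Fin 3) (w.1.adicCompletion L)) ∈ glInt 3 (w.1.adicCompletion L) :=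
    fun g => (hform g).symm ▸ mem_cmLocalIntegralLevel_iff_conj_mem_glInt L H' w hw hTint g
  -- (α) the transport
  rw [classOrbitalIntegral_indicator_complex_cmLocalIntegralLevel_eq_natCard_fixedBy L 3 H' v νG hH'c hdet hmG hνG δ hreg',
    natCard_fixedBy_cmLocalIntegralLevel_eq_of_frame L H' w hw e hlev δ]
  -- finiteness of the fixed cosets
  have hfinG : (MulAction.fixedBy ((cmDatum L 3 H').Local v ⧸ cmLocalIntegralLevel L 3 H' v) δ).Finite :=
    finite_fixedBy_quotient_of_isClosed δ (cmLocalIntegralLevel L 3 H' v) (isClosed_conjClass_local_of_isRegularElt L 3 H' v hH'c hdet δ hreg')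
      (isCompact_isOpen_cmLocalIntegralLevel L 3 H' v).2 (isCompact_isOpen_cmLocalIntegralLevel L 3 H' v).1
  have hfin := (finite_fixedCosets_cmLocalIntegralLevel_iff_of_frame L H' w hw e hlev δ).1 hfinG
  -- `2` is a unit at `v`
  have h2L : (2 : 𝓞 L) ∉ w.1.asIdeal := by
    have h2w : Valued.v (2 : w.1.adicCompletion L) = 1 := (isUnit_two_integer_iff_valued_eq_one L w.1).1 h2
    have e1 : (algebraMap L (w.1.adicCompletion L)) (algebraMap (𝓞 L) L 2) = 2 := by rw [map_ofNat, map_ofNat]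
    rw [← e1] at h2w
    change Valued.v ((algebraMap (𝓞 L) L 2 : L) : w.1.adicCompletion L) = 1 at h2w
    rw [HeightOneSpectrum.valuedAdicCompletion_eq_valuation', HeightOneSpectrum.valuation_of_algebraMap] at h2w
    exact HeightOneSpectrum.intValuation_eq_one_iff.1 h2w
  have h2F : (2 : 𝓞 ↥(maximalRealSubfield L)) ∉ v.asIdeal := by
    intro hmem
    apply h2L
    have hh := congrArg HeightOneSpectrum.asIdeal w.2
    rw [← hh] at hmem
    simp only [HeightOneSpectrum.under_asIdeal, Ideal.under_def, Ideal.mem_comap, map_ofNat] at hmem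
    exact hmem
  have h2v : Valued.v (2 : v.adicCompletion ↥(maximalRealSubfield L)) = 1 := valued_two_adicCompletion_eq_one v h2F
  -- Flicker's `y` with `y ȳ = −2`, read at `w`
  obtain ⟨-, -, -, y, -, -, -, -, -, hy⟩ := exists_flicker_scalars_of_nonsplit L v w hw hv h2v
  have hσw : ∀ z : LocalRing L v, conjLocal L (IsCMField.complexConj L) v z w = galAdicCompletionMap (L := L) (IsCMField.complexConj L) hw (z w) :=
    fun z => conjLocal_apply_eq_of_smul_eq (IsCMField.complexConj L) hc1 v w hw z
  have hyw : y w * galAdicCompletionMap (L := L) (IsCMField.complexConj L) hw (y w) = -2 := by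
    rw [← hσw, mul_comm]; exact (congrFun hy w : _)
  -- `χ_g(u)` is a unit (`G`-regularity)
  have hu : IsUnit ((finCharpolyTwo L v γH).eval (finGammaTwo L v γH)) := isUnit_eval_finCharpolyTwo_of_isLocalGRegular L v γH hreg
  -- the matrix of `e δ`
  have ht : (((e δ).val : GL (Fin 3) (w.1.adicCompletion L)) : Matrix (Fin 3) (Fin 3) (w.1.adicCompletion L)) =
      (T : Matrix (Fin 3) (Fin 3) (w.1.adicCompletion L)) *
        ((δ.val : GL (Fin 3) (UnitaryGroup.LocalRing L v)) : Matrix (Fin 3) (Fin 3) (UnitaryGroup.LocalRing L v)).map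
          (Pi.evalRingHom (fun w' : UnitaryGroup.PlacesOver L v => w'.1.adicCompletion L) w) *
        ((T⁻¹ : GL (Fin 3) (w.1.adicCompletion L)) : Matrix (Fin 3) (Fin 3) (w.1.adicCompletion L)) := by
    rw [hform δ, Units.val_mul, Units.val_mul]
    rfl
  -- (β)+(γ)
  have hX := natCard_fixedPoints_eq_phiTHn_of_finKappaAt_eq_one L v H' γH δ hH' w hw hv h2F hyw h hu hκ hN hn T hT ht hfin
  exact_mod_cast congrArg (fun r : ℚ => (r : ℂ)) hX

end Literature.NumberTheory.Rogawski1990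

end
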